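import Summits.Ventures.PercRepro.Night2BasisMass

/-!
# night-2: a loaded target is a good or a distance-2 target of a lossy big pair

Under `dshGT2` the third tier (`dshMissed`) never fires at a lossy big pair in cell `(2, 1)` with at most one fat
closure (a covered lossy big set has distance-2 targets, `d2Targets_nonempty_of_not_gtPts`), so every target with a
nonzero load is `insert x Q` (a good target) or `insert x (insert x' Q)` (a distance-2 target) of a lossy big pair
`(B, z)`, `Q = insert z B` (`exists_pair_of_dload_ne_zero`) — the shape of the LOADED targets, whose floor in
`vType` is `0` (paper NIGHT-2-g31 §3.3 (1)).
-/

namespace PercRepro.Shadow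

open PercRepro.ThmH PercRepro.PerFlat

variable {α : Type*} [DecidableEq α] {M : Matroid α} [M.Finite] {G : Finset α}

/-- A nonzero `dshGT2` share of a big pair comes from the good or the distance-2 tier. -/
theorem mem_gtTargets_or_d2Targets_of_dshGT2_ne_zero (hG : G ∈ flatsQ M (5 + 1)) (hd : (gr M \ G).card = 2)
    (hk : kColoops M G = 1) (hs : ∀ e ∈ gr M, ∀ f ∈ gr M, e ≠ f → rkN M {e, f} = 2)
    (hl : ∀ e ∈ gr M, M.Indep {e}) {B : Finset α} (hB : B ∈ thinMembers M 5 G)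
    (hbig : 5 ≤ (B \ coloops M G).card) {z : α} (hz : z ∈ G \ clF M B) {S : Finset α}
    (hne : dshGT2 M 5 G B z S ≠ 0) :
    loss M 5 G B z ≠ 0 ∧ (S ∈ gtTargets M 5 G B z ∨ S ∈ d2Targets M 5 G (insert z B)) := by
  have hloss : loss M 5 G B z ≠ 0 := fun h0 => hne (dshGT2_eq_zero_of_loss_eq_zero h0 S)
  refine ⟨hloss, ?_⟩
  unfold dshGT2 at hne
  split_ifs at hne with h1 h2 h3 h4
  · exact Or.inl h2
  · exact absurd rfl hne
  · exact Or.inr h4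
  · exact absurd rfl hne
  · -- the third tier: impossible, a covered lossy big set has distance-2 targets
    exact absurd (d2Targets_nonempty_of_not_gtPts hG hd hk hs hl hB hbig hz hloss h1) h3

/-- **A loaded target is a good or a distance-2 target of a lossy big pair.** -/
theorem exists_pair_of_dload_ne_zero (hG : G ∈ flatsQ M (5 + 1)) (hd : (gr M \ G).card = 2)
    (hk : kColoops M G = 1) (hs : ∀ e ∈ gr M, ∀ f ∈ gr M, e ≠ f → rkN M {e, f} = 2)
    (hl : ∀ e ∈ gr M, M.Indep {e}) {S : Finset α} (hne : dload M 5 G (bigP M G) (dshGT2 M 5 G) S ≠ 0) :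
    ∃ B ∈ thinMembers M 5 G, 5 ≤ (B \ coloops M G).card ∧ ∃ z ∈ G \ clF M B, loss M 5 G B z ≠ 0 ∧
      ((∃ x ∈ gtPts M 5 G (insert z B), S = insert x (insert z B)) ∨
        (∃ p ∈ d2Pts M 5 G (insert z B), S = insert p.1 (insert p.2 (insert z B)))) := by
  unfold dload at hne
  obtain ⟨B, hB, hBne⟩ := Finset.exists_ne_zero_of_sum_ne_zero hne
  obtain ⟨z, hz, hzne⟩ := Finset.exists_ne_zero_of_sum_ne_zero hBne
  rw [Finset.mem_filter] at hB
  obtain ⟨hloss, hmem⟩ := mem_gtTargets_or_d2Targets_of_dshGT2_ne_zero hG hd hk hs hl hB.1 hB.2 hz hzne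
  refine ⟨B, hB.1, hB.2, z, hz, hloss, ?_⟩
  rcases hmem with h | h
  · unfold gtTargets at h
    rw [Finset.mem_image] at h
    obtain ⟨x, hx, rfl⟩ := h
    exact Or.inl ⟨x, hx, rfl⟩
  · obtain ⟨p, hp, rfl⟩ := mem_d2Targets.1 h
    exact Or.inr ⟨p, hp, rfl⟩

end PercRepro.Shadow
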